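import Mathlib.Analysis.SpecialFunctions.Pow.Integral
import Literature.Analysis.FunctionSpaces.FourierSobolevNorm
import HarnessLib

/-!
# Elements of `Ḣ^s`, `s < d/2`, are tempered distributions: discharge of
`HomSobolev.exists_temperedDistribution`

Topic `Analysis/FunctionSpaces`; sibling proof file of `FourierSobolevNorm.lean` (which stays
untouched; D-0014: a named fact `def X : Prop` is discharged as `theorem X_holds : X`). It
**proves** `Literature.Analysis.FunctionSpaces.HomSobolev.exists_temperedDistribution_holds`:
for `s < d/2` and `d = dim E ≥ 1`, every element `g` of the Fourier-side realisation
`HomSobolev E F s = L²(E, ‖ξ‖^{2s} dξ; F)` of the homogeneous Sobolev space `Ḣ^s` defines a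
tempered distribution `u = 𝓕⁻¹ g ∈ 𝓢'(E, F)`, `u(φ) = ∫ (𝓕⁻¹φ)(ξ) · g(ξ) dξ` for all Schwartz `φ`
(Bahouri–Chemin–Danchin, *Fourier Analysis and Nonlinear PDE* (2011), Prop. 1.34: `Ḣ^s(ℝ^d)` is
a Hilbert space iff `s < d/2`; the "if" direction rests on the fact that for `s < d/2` a function
`ĝ` with `∫ |ξ|^{2s} |ĝ(ξ)|² dξ < ∞` is locally integrable, indeed `1_{B(0,1)} ĝ ∈ L¹` by the
Cauchy–Schwarz inequality because `∫_{B(0,1)} |ξ|^{-2s} dξ < ∞` exactly when `2s < d`, so that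
`ĝ ∈ 𝓢'` and `u = 𝓕⁻¹ ĝ` makes sense).

## Proof

The book is not held by the literature store (acquisition requested); the argument formalised is
the standard Cauchy–Schwarz one just recalled, organised through a single weighted measure so
that Mathlib's embedding `MeasureTheory.Lp.toTemperedDistribution` (an `L^p(μ)` class is a
tempered distribution as soon as `μ` has temperate growth, by Hölder) does the continuity
estimate:

1. `HomSobolev.integrable_norm_rpow_neg_mul_one_add_norm_rpow_neg`: for `a < d`, `d ≥ 1` and
   `r > d + |a|` the weight `‖ξ‖^{-a} (1 + ‖ξ‖)^{-r}` is integrable on `E` — on the unit ball it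
   is dominated by `‖ξ‖^{-a}` (Mathlib `integrableOn_ball_of_norm_le_rpow`, polar coordinates),
   off the unit ball by `(1 + ‖ξ‖)^{-(r - |a|)}` (Mathlib `integrable_one_add_norm`).
2. `HomSobolev.hasTemperateGrowth_withDensity_norm_rpow_neg`: hence the measure
   `μ_a = ‖ξ‖^{-a} dξ` has temperate growth (Mathlib `Measure.HasTemperateGrowth`) for `a < d`.
3. `HomSobolev.memLp_norm_rpow_smul_withDensity`: if `g ∈ L²(‖ξ‖^{2s} dξ)` then
   `‖ξ‖^{2s} g ∈ L²(μ_{2s})`, both squared norms being `∫ ‖ξ‖^{2s} ‖g‖² dξ` (the point `ξ = 0`,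
   where the weights degenerate, is Lebesgue-null as `d ≥ 1`).
4. `HomSobolev.integral_smul_toLp_norm_rpow_smul`: the pairing of the `L²(μ_{2s})` class of
   `‖ξ‖^{2s} g` with a test function `ψ` is `∫ ψ • (‖ξ‖^{2s} g) ‖ξ‖^{-2s} dξ = ∫ ψ • g dξ`.
5. `HomSobolev.exists_temperedDistribution_holds`: with `v ∈ 𝓢'` the distribution of step 4
   (Mathlib `Lp.toTemperedDistribution`, available by step 2 with `a = 2s < d`), take
   `u = 𝓕⁻¹ v` (Mathlib's inverse Fourier transform on `𝓢'`, `(𝓕⁻¹ v)(φ) = v(𝓕⁻¹ φ)`).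

No new definitions.

## References

* [BahouriCheminDanchin2011] H. Bahouri, J.-Y. Chemin, R. Danchin, *Fourier Analysis and
  Nonlinear Partial Differential Equations*, Grundlehren der mathematischen Wissenschaften 343,
  Springer (2011), doi:10.1007/978-3-642-16830-7, §1.4.1, Def. 1.31, Prop. 1.34.
-/

noncomputable section

open MeasureTheory TemperedDistribution ENNReal FourierTransform Module Metric Set Filter
open scoped SchwartzMap NNReal

namespace Literature.Analysis.FunctionSpaces

variable {E F : Type*} [NormedAddCommGroup E] [InnerProductSpace ℝ E] [FiniteDimensional ℝ E]
  [MeasurableSpace E] [BorelSpace E] [NormedAddCommGroup F] [InnerProductSpace ℂ F]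
  [CompleteSpace F]

namespace HomSobolev

/-! ### The weight `‖ξ‖^{-a} (1 + ‖ξ‖)^{-r}` and the measure `‖ξ‖^{-a} dξ` -/

/-- For `a < d = dim E`, `d ≥ 1`, and `r > d + |a|`, the function `ξ ↦ ‖ξ‖^{-a} (1 + ‖ξ‖)^{-r}`
is Lebesgue integrable on `E`: near the origin `‖ξ‖^{-a}` is integrable iff `a < d` (polar
coordinates; this is the integrability of `|ξ|^{-2s}` on `B(0,1)` for `s < d/2` used in
Bahouri–Chemin–Danchin 2011, proof of Prop. 1.34), and for `‖ξ‖ ≥ 1` the integrand is at most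
`(1 + ‖ξ‖)^{|a| - r}` with `r - |a| > d`. [folklore] -/
theorem integrable_norm_rpow_neg_mul_one_add_norm_rpow_neg (hE : 0 < finrank ℝ E) {a r : ℝ}
    (ha : a < finrank ℝ E) (hr : (finrank ℝ E : ℝ) + |a| < r) :
    Integrable (fun x : E => ‖x‖ ^ (-a) * (1 + ‖x‖) ^ (-r)) (volume : Measure E) := by
  have hr0 : 0 ≤ r := by
    have h1 := abs_nonneg a
    have h2 : (0 : ℝ) ≤ finrank ℝ E := Nat.cast_nonneg _
    linarith
  have hmeas : AEStronglyMeasurable (fun x : E => ‖x‖ ^ (-a) * (1 + ‖x‖) ^ (-r))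
      (volume : Measure E) :=
    Measurable.aestronglyMeasurable (by fun_prop)
  rw [← integrableOn_univ, ← union_compl_self (ball (0 : E) 1)]
  refine IntegrableOn.union ?_ ?_
  · -- on the unit ball the integrand is dominated by `‖x‖ ^ (-a)`
    refine integrableOn_ball_of_norm_le_rpow (Nat.succ_le_of_lt hE) ha (C := 1)
      (Eventually.of_forall fun x => ?_) hmeas
    rw [one_mul, Real.norm_of_nonneg (by positivity)]
    refine mul_le_of_le_one_right (by positivity) ?_
    exact Real.rpow_le_one_of_one_le_of_nonpos (by simp) (by linarith)
  · -- off the unit ball the integrand is dominated by `(1 + ‖x‖) ^ (-(r - |a|))`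
    have hint : Integrable (fun x : E => (1 + ‖x‖) ^ (-(r - |a|))) (volume : Measure E) :=
      integrable_one_add_norm (by linarith)
    refine Integrable.mono' hint.integrableOn hmeas.restrict ?_
    rw [ae_restrict_iff' measurableSet_ball.compl]
    refine Eventually.of_forall fun x hx => ?_
    simp only [mem_compl_iff, mem_ball, dist_zero_right, not_lt] at hx
    rw [Real.norm_of_nonneg (by positivity)]
    have h1 : (0 : ℝ) < 1 + ‖x‖ := by positivity
    have hxa : ‖x‖ ^ (-a) ≤ (1 + ‖x‖) ^ |a| := by
      rcases le_or_gt 0 a with ha0 | ha0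
      · exact (Real.rpow_le_one_of_one_le_of_nonpos hx (by linarith)).trans
          (Real.one_le_rpow (by linarith) (abs_nonneg a))
      · rw [abs_of_neg ha0]
        exact Real.rpow_le_rpow (norm_nonneg _) (by linarith) (by linarith)
    calc ‖x‖ ^ (-a) * (1 + ‖x‖) ^ (-r)
        ≤ (1 + ‖x‖) ^ |a| * (1 + ‖x‖) ^ (-r) := by gcongr
      _ = (1 + ‖x‖) ^ (-(r - |a|)) := by
          rw [← Real.rpow_add h1]
          congr 1
          ring

/-- For `a < d = dim E`, `d ≥ 1`, the measure `‖ξ‖^{-a} dξ` on `E` has temperate growth in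
Mathlib's sense (`(1 + ‖ξ‖)^{-n}` is integrable against it for some `n`; any `n > d + |a|` works
by `integrable_norm_rpow_neg_mul_one_add_norm_rpow_neg`). With `a = 2s` this is the measure
against which `‖ξ‖^{2s} ĝ`, `ĝ ∈ L²(|ξ|^{2s} dξ)`, is square integrable, for `s < d/2`
(Bahouri–Chemin–Danchin 2011, Prop. 1.34). [folklore] -/
theorem hasTemperateGrowth_withDensity_norm_rpow_neg (hE : 0 < finrank ℝ E) {a : ℝ}
    (ha : a < finrank ℝ E) :
    ((volume : Measure E).withDensity fun x => ENNReal.ofReal (‖x‖ ^ (-a))).HasTemperateGrowth := by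
  obtain ⟨n, hn⟩ := exists_nat_gt ((finrank ℝ E : ℝ) + |a|)
  refine ⟨⟨n, ?_⟩⟩
  rw [integrable_withDensity_iff_integrable_smul' (by fun_prop)
    (Eventually.of_forall fun _ => ofReal_lt_top)]
  refine (integrable_norm_rpow_neg_mul_one_add_norm_rpow_neg hE ha hn).congr
    (Eventually.of_forall fun x => ?_)
  simp only [smul_eq_mul]
  rw [ENNReal.toReal_ofReal (by positivity)]

/-! ### From `L²(‖ξ‖^{2s} dξ)` to `L²(‖ξ‖^{-2s} dξ)` -/

/-- Off the origin, i.e. Lebesgue-almost everywhere when `dim E ≥ 1`. [folklore] -/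
theorem ae_ne_zero (hE : 0 < finrank ℝ E) : ∀ᵐ x ∂(volume : Measure E), x ≠ 0 := by
  haveI : Nontrivial E := Module.nontrivial_of_finrank_pos (R := ℝ) hE
  rw [ae_iff]
  simp

omit [CompleteSpace F] in
/-- If `g ∈ L²(‖ξ‖^{2s} dξ)` (as a function: `MemLp g 2 (homSobolevMeasure E s)`) and
`dim E ≥ 1`, then `ξ ↦ ‖ξ‖^{2s} g(ξ)` lies in `L²(‖ξ‖^{-2s} dξ)`: both squared norms equal
`∫ ‖ξ‖^{2s} ‖g(ξ)‖² dξ`, the weights `‖ξ‖^{-2s} (‖ξ‖^{2s})²` and `‖ξ‖^{2s}` agreeing off the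
Lebesgue-null point `ξ = 0`; and `g`, a priori only `‖ξ‖^{2s} dξ`-a.e. strongly measurable, is
Lebesgue-a.e. strongly measurable because the density `‖ξ‖^{2s}` is a.e. positive (the two
measures have the same null sets). This is the bookkeeping behind `|ĝ| = |ξ|^{-s} (|ξ|^s |ĝ|)`
in Bahouri–Chemin–Danchin 2011, proof of Prop. 1.34. [folklore] -/
theorem memLp_norm_rpow_smul_withDensity (hE : 0 < finrank ℝ E) {s : ℝ} {g : E → F}
    (hg : MemLp g 2 (homSobolevMeasure E s)) :
    MemLp (fun x => (‖x‖ ^ (2 * s) : ℝ) • g x) 2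
      ((volume : Measure E).withDensity fun x => ENNReal.ofReal (‖x‖ ^ (-(2 * s)))) := by
  rw [homSobolevMeasure_def] at hg
  have h0 := ae_ne_zero hE
  have hw_meas : Measurable fun x : E => ‖x‖ₑ ^ (2 * s) := by fun_prop
  have hw_ne_zero : ∀ᵐ x ∂(volume : Measure E), ‖x‖ₑ ^ (2 * s) ≠ 0 := by
    filter_upwards [h0] with x hx
    simp [ENNReal.rpow_eq_zero_iff, hx]
  have hw_lt_top : ∀ᵐ x ∂(volume : Measure E), ‖x‖ₑ ^ (2 * s) < ∞ := by
    filter_upwards [h0] with x hx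
    simp [lt_top_iff_ne_top, ENNReal.rpow_eq_top_iff, hx]
  -- `g` is Lebesgue-a.e. strongly measurable
  have hg_vol : AEStronglyMeasurable g (volume : Measure E) :=
    hg.1.mono_ac (withDensity_absolutelyContinuous' hw_meas.aemeasurable hw_ne_zero)
  have hρ_meas : Measurable fun x : E => ENNReal.ofReal (‖x‖ ^ (-(2 * s))) := by fun_prop
  have hG_meas : AEStronglyMeasurable (fun x => (‖x‖ ^ (2 * s) : ℝ) • g x)
      ((volume : Measure E).withDensity fun x => ENNReal.ofReal (‖x‖ ^ (-(2 * s)))) :=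
    ((show Measurable fun x : E => (‖x‖ ^ (2 * s) : ℝ) by fun_prop).aestronglyMeasurable.smul
      hg_vol).mono_ac (withDensity_absolutelyContinuous _ _)
  rw [memLp_two_iff_integrable_sq_norm hG_meas,
    integrable_withDensity_iff_integrable_smul' hρ_meas
      (Eventually.of_forall fun _ => ofReal_lt_top)]
  have hg2 : Integrable (fun x => (‖x‖ₑ ^ (2 * s)).toReal • ‖g x‖ ^ 2) (volume : Measure E) := by
    rw [← integrable_withDensity_iff_integrable_smul' hw_meas hw_lt_top]
    exact (memLp_two_iff_integrable_sq_norm hg.1).1 hg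
  refine hg2.congr ?_
  filter_upwards [h0] with x hx
  have hxpos : 0 < ‖x‖ := norm_pos_iff.2 hx
  simp only [smul_eq_mul, norm_smul, Real.norm_of_nonneg (Real.rpow_nonneg hxpos.le _), mul_pow]
  rw [ENNReal.toReal_ofReal (Real.rpow_nonneg hxpos.le _), ← ENNReal.toReal_rpow, toReal_enorm,
    Real.rpow_neg hxpos.le, sq (‖x‖ ^ (2 * s)), ← mul_assoc, ← mul_assoc,
    inv_mul_cancel₀ (Real.rpow_pos_of_pos hxpos _).ne', one_mul]

omit [CompleteSpace F] in
/-- The pairing of the `L²(‖ξ‖^{-2s} dξ)` class of `‖ξ‖^{2s} g` with a test function `ψ` is the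
Lebesgue pairing of `g` with `ψ`: `∫ ψ • (‖ξ‖^{2s} g) ‖ξ‖^{-2s} dξ = ∫ ψ • g dξ`
(`‖ξ‖^{-2s} ‖ξ‖^{2s} = 1` off the Lebesgue-null point `ξ = 0`, `dim E ≥ 1`). With `ψ = 𝓕⁻¹φ`
this is the formula `⟨𝓕⁻¹ ĝ, φ⟩ = ∫ 𝓕⁻¹φ · ĝ` for the distribution defined by `ĝ ∈ Ḣ^s`,
`s < d/2` (Bahouri–Chemin–Danchin 2011, Prop. 1.34). [folklore] -/
theorem integral_smul_toLp_norm_rpow_smul (hE : 0 < finrank ℝ E) {s : ℝ} {g : E → F}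
    (hG : MemLp (fun x => (‖x‖ ^ (2 * s) : ℝ) • g x) 2
      ((volume : Measure E).withDensity fun x => ENNReal.ofReal (‖x‖ ^ (-(2 * s)))))
    (ψ : E → ℂ) :
    ∫ x, ψ x • (hG.toLp _ : E → F) x
        ∂((volume : Measure E).withDensity fun x => ENNReal.ofReal (‖x‖ ^ (-(2 * s)))) =
      ∫ x, ψ x • g x := by
  calc ∫ x, ψ x • (hG.toLp _ : E → F) x
          ∂((volume : Measure E).withDensity fun x => ENNReal.ofReal (‖x‖ ^ (-(2 * s))))
      = ∫ x, ψ x • ((‖x‖ ^ (2 * s) : ℝ) • g x)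
          ∂((volume : Measure E).withDensity fun x => ENNReal.ofReal (‖x‖ ^ (-(2 * s)))) := by
        refine integral_congr_ae ?_
        filter_upwards [hG.coeFn_toLp] with x hx
        rw [hx]
    _ = ∫ x, (ENNReal.ofReal (‖x‖ ^ (-(2 * s)))).toReal • (ψ x • ((‖x‖ ^ (2 * s) : ℝ) • g x)) :=
        integral_withDensity_eq_integral_toReal_smul (by fun_prop)
          (Eventually.of_forall fun _ => ofReal_lt_top) _
    _ = ∫ x, ψ x • g x := by
        refine integral_congr_ae ?_
        filter_upwards [ae_ne_zero hE] with x hx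
        have hxpos : 0 < ‖x‖ := norm_pos_iff.2 hx
        rw [ENNReal.toReal_ofReal (Real.rpow_nonneg hxpos.le _), smul_comm (ψ x), smul_smul,
          Real.rpow_neg hxpos.le, inv_mul_cancel₀ (Real.rpow_pos_of_pos hxpos _).ne', one_smul]

/-! ### The discharge -/

/-- **Discharge of `HomSobolev.exists_temperedDistribution`** (Bahouri–Chemin–Danchin 2011,
Prop. 1.34: for `s < d/2` the homogeneous Sobolev space `Ḣ^s(ℝ^d)` is a Hilbert space of
tempered distributions, the point being that `ĝ ∈ L²(|ξ|^{2s} dξ)` is then locally integrable,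
`1_{B(0,1)} ĝ ∈ L¹` by Cauchy–Schwarz with `∫_{B(0,1)} |ξ|^{-2s} dξ < ∞`). For `2s < dim E`,
`0 < dim E` and `g ∈ HomSobolev E F s = L²(E, ‖ξ‖^{2s} dξ; F)` there is `u ∈ 𝓢'(E, F)` with
`u(φ) = ∫ (𝓕⁻¹φ)(ξ) • g(ξ) dξ` for every Schwartz `φ`, namely `u = 𝓕⁻¹ v` where `v ∈ 𝓢'` is the
`L²(‖ξ‖^{-2s} dξ)` class of `‖ξ‖^{2s} g` (Mathlib `Lp.toTemperedDistribution`; the measure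
`‖ξ‖^{-2s} dξ` has temperate growth exactly because `2s < d`,
`hasTemperateGrowth_withDensity_norm_rpow_neg`), whose pairing with `ψ` is `∫ ψ • g dξ`
(`integral_smul_toLp_norm_rpow_smul`). [cite: BahouriCheminDanchin2011, Prop. 1.34] -/
theorem exists_temperedDistribution_holds {s : ℝ} :
    exists_temperedDistribution (E := E) (F := F) (s := s) := by
  intro hs hE g₀
  haveI := hasTemperateGrowth_withDensity_norm_rpow_neg (E := E) hE hs
  have hG := memLp_norm_rpow_smul_withDensity hE
    (Lp.memLp (toLp s g₀ : Lp F 2 (homSobolevMeasure E s)))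
  refine ⟨𝓕⁻ (Lp.toTemperedDistribution (hG.toLp _) : 𝓢'(E, F)), fun φ => ?_⟩
  rw [fourierInv_apply, Lp.toTemperedDistribution_apply]
  exact integral_smul_toLp_norm_rpow_smul hE hG _

end HomSobolev

end Literature.Analysis.FunctionSpaces
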